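/-
Copyright: the b2b-balaban T⁴-continuum CRUX team, row NE7b leaf lineage `t4-ne7b-formalise-leaf-01` (gen 86). Project licence.
-/
import Literature.MathematicalPhysics.QuantumFieldTheory.Balaban1983to89.B5Hk165TranslZd
import Literature.MathematicalPhysics.QuantumFieldTheory.Balaban1983to89.B5Ineq167UpperZd

/-!
# THE ENGINE OF AN A-POSTERIORI AGMON ∕ COMBES–THOMAS LETTER ON `ker Q′` WITH BLOCK-CONSTANT WEIGHTS, BY VALUE:
# `D ∈ ℓ²(ℤ^d)`, zero block sums, `(−Δ)D = g∘blk − R` with `R` finitely supported, block weight `w` with bond ratios `≤ 2 + 2η`,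
# intra-block Poincaré constant `gap` ⟹ `(gap − d·η)·‖w∘blk·D‖_{ℓ²} ≤ ‖w∘blk·R‖_{ℓ²}`
# (row NE7b, node U5c; PRICING-NE7b v124 §3 NL-NE7b-1′ limb 1b (e1); [folklore] over `B5Hk103Unique`∕`B5Hk165TranslZd` BY NAME)

Cell `pub-balaban`, sub-cell `t4`, spine estimate NE7b (`T4WeightBudget.RelWeightBound`; the cell's OWN estimate — NOT PRINTED in
[Bałaban 1983–89], NOT PROVED).  Crux-route work under `Spine/NE7b/` by a row leaf (`t4-ne7b-formalise-leaf-01` gen 86) under FREEZE (0)'s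
crux-prover clause; NOTHING of Bałaban's is named as a Lean object, valued or asserted; no `T4Continuum/Support` leaf typed; no `def` (the
field `D`, its block-constant part `g`, its residual `R` and window `T`, the block weight `w` and the constants `η`, `W`, `gap` are CARRIED BY
HYPOTHESES); zero `sorry`.  Import: `Literature.….B5Hk165TranslZd` (hence `B5Hk103Unique`, `B6QGQLower276`): sites `X d = ℤ^d`, blocks `B n y`
of side `n + 1`, `blk`, `loc`, the minus-Laplacian row `lapRow`, and the `ℓ²(ℤ^d)` bookkeeping (`summable_mul_of_sq`, `tsum_addRight`, `tsum_blocks`).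

WHY.  PRICING-NE7b v124 §3 keeps R-P1's NL-NE7b-1′ limb 1b (the one-shot chart letter BY VALUE at a small fixed side, MIXED currency of record,
W-ne7bp1-g113-3) OPEN AT KERNEL WEIGHT, F733 (e): (e1) an EXPLICIT decay letter for `kerH` («the tree's `cH∕deltaH` and the existential `κ, C` are
useless by value»), (e2) Lean-checkable near-field values, (e3) an images ∕ truncation identity — «none typed or claimed».  THIS FILE is the engine
of a letter that serves (e1) BY VALUE and turns (e2)+(e3) into ONE FINITE exact-rational computation (sibling `BlockSectionAgmonLetter`: the engine
read on `D = kerH n a · 0 − φ` for any finitely supported competitor `φ` with the section's block sums; `BlockSectionRowSumCertificate`: the numbers).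
MECHANISM (Agmon's method with weights that COMMUTE with the block-mean projection; Combes–Thomas 1973 in symmetrised form): test `(−Δ)D = g∘blk − R`
against `w(blk)²·D`.  The block-constant part `g∘blk` dies on the zero block sums of `w(blk)²D`, so `J := Σ' w(blk)²D·(−Δ)D = −Σ_T (w∘blk·D)(w∘blk·R)`
(§2 (I-a)); on the other hand `J = Σ_μ Σ'[(v_q − v_{q+e_μ})² − (ρ_{q,μ} − 2)·v_q v_{q+e_μ}]`, `v = w∘blk·D`, `ρ_{q,μ} = θ_q∕θ_{q+e_μ} + θ_{q+e_μ}∕θ_q`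
(`= 2` inside a block, `≤ 2 + 2η` across a face — §2 (I-b)); the Dirichlet energy is `≥ gap·Σ'v²` block by block (intra-block, below-face bonds
only; `v` has zero block sums because the weight is block-constant — §2 (II)) and the perturbation is `≤ d·η·Σ'v²` (across a face `(ρ − 2)|v_qv_{q+e}|
≤ η(v_q² + v_{q+e}²)`, each site has ONE upper and ONE lower face per direction, disjoint for `n ≥ 1` — §2 (III)); Cauchy–Schwarz on `T` (§2 (IV)).
For `w = e^{κN∘blk}` with `N` 1-Lipschitz on the block lattice (`|·|₁`, `|·|_∞`, their truncations `min(N, T)` — bounded), `η = cosh κ − 1`; for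
`w = t^{min(N,T)}`, `N` integer-valued 1-Lipschitz, `η = (t − 1)²∕(2t)` (rational: `t = 3∕2 ⇒ η = 1∕12`, and at side 2, `d = 4`: `gap − dη = 2 − 1∕3 = 5∕3`).

WHAT IS PROVED (every `d`, every block side `n + 1 ≥ 2`; all [folklore]):
* §1 `blk_sub_bshift` (`blk(p − (n+1)y) = blk p − y`), `sub_bshift_injective`, `lapRow_sub'`, `summable_lapRow_sq` (`(−Δ)D ∈ ℓ²`); by name from the
  tree: `B5Ineq167UpperZd.blk_add_e_of_eq` (across a face the block label steps by `e_μ`), `B5Hk103Minimizer.summable_lapRow_mul₂`.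
* §2 **`engine`**: `D ∈ ℓ²(ℤ^d)` (`hD2`) with zero block sums (`hD0`) and `lapRow D q = g (blk q) − R q` (`hlap`), `R = 0` off the finite `T` (`hT`);
  `0 < w ≤ W`, `w(y)∕w(y+e_μ) + w(y+e_μ)∕w(y) ≤ 2 + 2η` (`0 ≤ η`); `hgap : Σ_{B(y)}u = 0 → gap·Σ_{B(y)}u² ≤ Σ_{q∈B(y)}Σ_μ[loc_μ q < n](u q − u(q+e_μ))²`
  ⟹ **`(gap − d·η)·√(Σ'_q (w(blk q)·D q)²) ≤ √(Σ_{q∈T}(w(blk q)·R q)²)`** (no sign hypothesis on `gap − dη`: trivially true when it is `≤ 0`).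

HONEST: [folklore]; an abstract `ℓ²(ℤ^d)` inequality — no kernel of Bałaban's, no number; the gap is a DISPLAYED hypothesis (side 2: the zero-mean
hypercube gap `2`, sibling `HypercubeBlockGap`; CPT's `n(n−1)` form gives `(n(n−1))⁻¹`-type constants for any side); nothing of (A3) ∕ NC-NE7b-α;
BY-NAME EFFECT ON THE WALL: NONE.  NE7b NOT PRINTED ∕ NOT PROVED; spine PROVED 0∕9; rung (B)+1 on a FINITE torus — NOT infinite volume, NOT the
mass gap, NOT Clay.  HONEST DEPENDENCY: continuum YM on T⁴ ⇐ BetaPertH ∧ nine spine estimates (0∕9 proved); BetaPertH ⇐ (D1) ∧ (D4) ∧ CAP+tail;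
G-an2-4 gates asym, D1 and NE2∕3∕4.
-/

set_option autoImplicit false

namespace Summit.QuantumFields.BalabanUV.T4Continuum.NE7b.BlockSectionAgmonEngine

open Finset
open Literature.MathematicalPhysics.QuantumFieldTheory.Balaban1983to89
open B6QGQLower276 (X B e blk loc side mem_B sum_B_const blk_add_e_of_lt loc_add_e_of_eq loc_le loc_nonneg
  add_e_apply_self add_e_apply_ne e_apply_self e_apply_ne ediv_emod_add_one_of_eq chart blk_chart locFin chart_blk_locFin)
open B5Hk103ScalarZd (summable_blocks tsum_blocks)
open B5Hk103Unique (lapRow summable_mul_of_sq summable_sq_shift tsum_addRight summable_addRight_iff)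
open B5Hk103Minimizer (summable_lapRow_mul₂)
open B5Hk165TranslZd (bshift chart_add)
open B5Ineq167UpperZd (blk_add_e_of_eq summable_sq_of_support)

noncomputable section

variable {d : ℕ}

/-! ## §1  Lattice bookkeeping [folklore] -/

/-- The block label of `p − (n+1)·y` is `blk p − y`. [folklore] -/
theorem blk_sub_bshift (n : ℕ) (p y : X d) : blk n (p - bshift n y) = blk n p - y := by
  have h1 : p - bshift n y = chart n (blk n p - y) (locFin n p) := by
    have h := chart_add n (blk n p - y) y (locFin n p)
    rw [sub_add_cancel, chart_blk_locFin] at h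
    exact (eq_sub_of_add_eq h.symm).symm
  rw [h1, blk_chart]

/-- `y ↦ p − (n+1)·y` is injective. [folklore] -/
theorem sub_bshift_injective (n : ℕ) (p : X d) : Function.Injective fun y : X d => p - bshift n y := by
  intro y₁ y₂ h
  have h' : blk n (p - bshift n y₁) = blk n (p - bshift n y₂) := by simp only [h]
  rw [blk_sub_bshift, blk_sub_bshift] at h'
  exact sub_right_injective h'

/-- `(−Δ)` is linear: `lapRow (D₁ − D₂) = lapRow D₁ − lapRow D₂`. [folklore] -/
theorem lapRow_sub' (D₁ D₂ : X d → ℝ) (q : X d) :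
    lapRow (fun r => D₁ r - D₂ r) q = lapRow D₁ q - lapRow D₂ q := by
  simp only [lapRow, ← Finset.sum_sub_distrib]
  refine Finset.sum_congr rfl fun μ _ => ?_
  ring

/-- `(−Δ)D` is square-summable for square-summable `D` (`‖(−Δ)D‖² ≤ …`, via `(Σ_{k≤2d+1} x_k)² ≤ (2d+1)Σ x_k²`). [folklore] -/
theorem summable_lapRow_sq {D : X d → ℝ} (hD2 : Summable fun p => D p ^ 2) :
    Summable fun p => lapRow D p ^ 2 := by
  -- `lapRow D p = Σ_μ (2D p − D(p+e) − D(p−e))`; bound the square by Cauchy–Schwarz over the `d` directions and within.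
  have hdir : ∀ μ : Fin d, Summable fun p => (2 * D p - D (p + e μ) - D (p - e μ)) ^ 2 := by
    intro μ
    have h1 : Summable fun p => D (p + e μ) ^ 2 := summable_sq_shift hD2 (e μ)
    have h2 : Summable fun p => D (p - e μ) ^ 2 := by
      simpa [sub_eq_add_neg] using summable_sq_shift hD2 (-e μ)
    refine Summable.of_nonneg_of_le (fun p => sq_nonneg _) (fun p => ?_) (((hD2.mul_left 12).add (h1.mul_left 3)).add (h2.mul_left 3))
    nlinarith [sq_nonneg (2 * D p + D (p + e μ)), sq_nonneg (2 * D p + D (p - e μ)), sq_nonneg (D (p + e μ) - D (p - e μ)),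
      sq_nonneg (D p), sq_nonneg (D (p + e μ)), sq_nonneg (D (p - e μ))]
  have hsum : Summable fun p => ∑ μ : Fin d, (2 * D p - D (p + e μ) - D (p - e μ)) ^ 2 := summable_sum fun μ _ => hdir μ
  refine Summable.of_nonneg_of_le (fun p => sq_nonneg _) (fun p => ?_) (hsum.mul_left (Fintype.card (Fin d) : ℝ))
  rw [lapRow]
  have h := sq_sum_le_card_mul_sum_sq (s := (Finset.univ : Finset (Fin d)))
    (f := fun μ => 2 * D p - D (p + e μ) - D (p - e μ))
  simpa using h

/-! ## §2  The engine: an a-posteriori Agmon ∕ Combes–Thomas bound on `ker Q′` with block-constant weights [folklore] -/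

/-- **THE ENGINE.**  `D ∈ ℓ²(ℤ^d)` with zero block sums whose minus-Laplacian is block-constant up to a finitely supported `R`
(`(−Δ)D = g∘blk − R`, `R = 0` off `T`); a block weight `w > 0`, `w ≤ W`, with bond ratios `w(y)∕w(y+e_μ) + w(y+e_μ)∕w(y) ≤ 2 + 2η`;
the intra-block Poincaré letter with constant `gap` on zero-sum block fields (below-face bonds `loc_μ q < n`).  Then
`(gap − d·η)·√(Σ'_q (w(blk q)·D q)²) ≤ √(Σ_{q∈T}(w(blk q)·R q)²)`.  Mechanism: `J := Σ' w(blk)²·D·(−Δ)D` equals `−Σ_T (w∘blk·D)(w∘blk·R)`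
(the block-constant part dies on the zero block sums of `w(blk)²D`), and equals the weighted Dirichlet form
`Σ_μ Σ'[(v_q − v_{q+e_μ})² − (ρ_{q,μ} − 2)v_qv_{q+e_μ}]`, `v = w∘blk·D`, `ρ = θ_q∕θ_{q+e_μ} + θ_{q+e_μ}∕θ_q ∈ [2, 2+2η]`, `= 2` inside blocks;
the energy is `≥ gap·Σ'v²` block by block and the perturbation `≤ d·η·Σ'v²` (one cross bond per site and direction, `n ≥ 1`); Cauchy–Schwarz. [folklore] -/
theorem engine (n : ℕ) (hn : 1 ≤ n) (D g R : X d → ℝ) (T : Finset (X d))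
    (hD2 : Summable fun q => D q ^ 2) (hD0 : ∀ y : X d, ∑ q ∈ B n y, D q = 0)
    (hlap : ∀ q, lapRow D q = g (blk n q) - R q) (hT : ∀ q ∉ T, R q = 0)
    (w : X d → ℝ) (η W : ℝ) (hw0 : ∀ y, 0 < w y) (hwW : ∀ y, w y ≤ W) (hη : 0 ≤ η)
    (hwρ : ∀ (y : X d) (μ : Fin d), w y / w (y + e μ) + w (y + e μ) / w y ≤ 2 + 2 * η)
    (gap : ℝ)
    (hgap : ∀ (y : X d) (u : X d → ℝ), ∑ q ∈ B n y, u q = 0 →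
      gap * ∑ q ∈ B n y, u q ^ 2 ≤ ∑ q ∈ B n y, ∑ μ : Fin d, (if loc n q μ < n then (u q - u (q + e μ)) ^ 2 else 0)) :
    (gap - d * η) * Real.sqrt (∑' q, (w (blk n q) * D q) ^ 2) ≤ Real.sqrt (∑ q ∈ T, (w (blk n q) * R q) ^ 2) := by
  classical
  -- the weight on sites and the weighted field
  set θ : X d → ℝ := fun q => w (blk n q) with hθ
  set v : X d → ℝ := fun q => θ q * D q with hv
  have hθ0 : ∀ q, 0 < θ q := fun q => hw0 _
  have hθne : ∀ q, θ q ≠ 0 := fun q => (hθ0 q).ne'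
  -- ratios along a bond: `= 1` inside a block, controlled across a face
  have hratio : ∀ (q : X d) (μ : Fin d), θ q / θ (q + e μ) + θ (q + e μ) / θ q ≤ 2 + 2 * η := by
    intro q μ
    rcases (loc_le n q μ).lt_or_eq with hlt | heq
    · have : θ (q + e μ) = θ q := by simp only [hθ, (blk_add_e_of_lt hlt).1]
      rw [this, div_self (hθne q)]; linarith
    · have : θ (q + e μ) = w (blk n q + e μ) := by simp only [hθ, blk_add_e_of_eq heq]
      rw [this]; exact hwρ _ _
  have hratio_in : ∀ (q : X d) (μ : Fin d), loc n q μ < n → θ (q + e μ) = θ q := fun q μ hlt => by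
    simp only [hθ, (blk_add_e_of_lt hlt).1]
  have hratio_le : ∀ (q : X d) (μ : Fin d), θ q / θ (q + e μ) ≤ 2 + 2 * η := fun q μ =>
    le_trans (le_add_of_nonneg_right (div_pos (hθ0 _) (hθ0 _)).le) (hratio q μ)
  have hratio_le' : ∀ (q : X d) (μ : Fin d), θ (q + e μ) / θ q ≤ 2 + 2 * η := fun q μ =>
    le_trans (le_add_of_nonneg_left (div_pos (hθ0 _) (hθ0 _)).le) (hratio q μ)
  -- summability
  have hv2 : Summable fun q => v q ^ 2 := by
    refine Summable.of_nonneg_of_le (fun q => sq_nonneg _) (fun q => ?_) (hD2.mul_left (W ^ 2))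
    have h1 : θ q ^ 2 ≤ W ^ 2 := pow_le_pow_left₀ (hθ0 q).le (hwW _) 2
    simp only [hv, mul_pow]
    exact mul_le_mul_of_nonneg_right h1 (sq_nonneg _)
  have hR2 : Summable fun q => R q ^ 2 := summable_sq_of_support hT
  have hθR2 : Summable fun q => (θ q * R q) ^ 2 :=
    summable_sq_of_support (T := T) fun q hq => by rw [hT q hq, mul_zero]
  have hlap2 : Summable fun q => lapRow D q ^ 2 := summable_lapRow_sq hD2
  have hθv2 : Summable fun q => (θ q * v q) ^ 2 := by
    refine Summable.of_nonneg_of_le (fun q => sq_nonneg _) (fun q => ?_) (hv2.mul_left (W ^ 2))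
    have h1 : θ q ^ 2 ≤ W ^ 2 := pow_le_pow_left₀ (hθ0 q).le (hwW _) 2
    rw [mul_pow]
    exact mul_le_mul_of_nonneg_right h1 (sq_nonneg _)
  -- (I-a)  `J = −Σ_T (θ v) R`
  have hJ1 : ∑' q, (θ q * v q) * lapRow D q = -∑ q ∈ T, v q * (θ q * R q) := by
    have hgsum : Summable fun q => (θ q * v q) * g (blk n q) := by
      have : (fun q => (θ q * v q) * g (blk n q)) = fun q => (θ q * v q) * lapRow D q + (θ q * v q) * R q := by
        funext q; rw [hlap q]; ring
      rw [this]
      exact (summable_lapRow_mul₂ hD2 hθv2 |>.congr fun q => by ring).add (summable_mul_of_sq hθv2 hR2)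
    have hzero : ∑' q, (θ q * v q) * g (blk n q) = 0 := by
      rw [← tsum_blocks n hgsum]
      have hblock : ∀ y : X d, ∑ q ∈ B n y, (θ q * v q) * g (blk n q) = w y ^ 2 * g y * ∑ q ∈ B n y, D q := by
        intro y
        rw [Finset.mul_sum]
        refine Finset.sum_congr rfl fun q hq => ?_
        simp only [hθ, hv, mem_B.1 hq]; ring
      simp only [hblock, hD0, mul_zero, tsum_zero]
    have hsplit : (fun q => (θ q * v q) * lapRow D q) = fun q => (θ q * v q) * g (blk n q) - v q * (θ q * R q) := by
      funext q; rw [hlap q]; ring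
    rw [hsplit, hgsum.tsum_sub (summable_mul_of_sq hv2 hθR2), hzero, zero_sub,
      tsum_eq_sum (s := T) (fun q hq => by rw [hT q hq]; ring)]
  -- (I-b)  the weighted Dirichlet form
  have hvv : ∀ μ : Fin d, Summable fun q => v q * v (q + e μ) := fun μ =>
    summable_mul_of_sq hv2 (summable_sq_shift hv2 (e μ))
  have hvv' : ∀ μ : Fin d, Summable fun q => v (q + e μ) ^ 2 := fun μ => summable_sq_shift hv2 (e μ)
  have hfwd : ∀ μ : Fin d, Summable fun q => θ q / θ (q + e μ) * (v q * v (q + e μ)) := by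
    intro μ
    refine Summable.of_norm_bounded ((hvv μ).abs.mul_left (2 + 2 * η)) fun q => ?_
    rw [Real.norm_eq_abs, abs_mul, abs_of_pos (div_pos (hθ0 _) (hθ0 _))]
    exact mul_le_mul_of_nonneg_right (hratio_le q μ) (abs_nonneg _)
  have hbwd : ∀ μ : Fin d, Summable fun q => θ (q + e μ) / θ q * (v q * v (q + e μ)) := by
    intro μ
    refine Summable.of_norm_bounded ((hvv μ).abs.mul_left (2 + 2 * η)) fun q => ?_
    rw [Real.norm_eq_abs, abs_mul, abs_of_pos (div_pos (hθ0 _) (hθ0 _))]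
    exact mul_le_mul_of_nonneg_right (hratio_le' q μ) (abs_nonneg _)
  -- pointwise expansion of the summand of `J`
  have hpoint : ∀ q, (θ q * v q) * lapRow D q = ∑ μ : Fin d,
      (2 * v q ^ 2 - θ q / θ (q + e μ) * (v q * v (q + e μ)) - θ q / θ (q - e μ) * (v q * v (q - e μ))) := by
    intro q
    rw [lapRow, Finset.mul_sum]
    refine Finset.sum_congr rfl fun μ _ => ?_
    have h1 := hθne (q + e μ)
    have h2 := hθne (q - e μ)
    simp only [hv]
    field_simp
  have hJ2 : ∑' q, (θ q * v q) * lapRow D q = ∑ μ : Fin d,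
      (2 * ∑' q, v q ^ 2 - ∑' q, (θ q / θ (q + e μ) + θ (q + e μ) / θ q) * (v q * v (q + e μ))) := by
    have hbwd' : ∀ μ : Fin d, Summable fun q => θ q / θ (q - e μ) * (v q * v (q - e μ)) := by
      intro μ
      have h := (summable_addRight_iff (F := fun q => θ q / θ (q - e μ) * (v q * v (q - e μ))) (e μ)).1
      apply h
      simp only [add_sub_cancel_right]
      have : (fun q => θ (q + e μ) / θ q * (v (q + e μ) * v q)) = fun q => θ (q + e μ) / θ q * (v q * v (q + e μ)) := by
        funext q; ring
      rw [this]; exact hbwd μ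
    rw [tsum_congr hpoint, Summable.tsum_finsetSum fun μ _ => (((hv2.mul_left 2).sub (hfwd μ)).sub (hbwd' μ))]
    refine Finset.sum_congr rfl fun μ _ => ?_
    rw [((hv2.mul_left 2).sub (hfwd μ)).tsum_sub (hbwd' μ), (hv2.mul_left 2).tsum_sub (hfwd μ), tsum_mul_left]
    have hshift : ∑' q, θ q / θ (q - e μ) * (v q * v (q - e μ)) = ∑' q, θ (q + e μ) / θ q * (v q * v (q + e μ)) := by
      rw [← tsum_addRight (F := fun q => θ q / θ (q - e μ) * (v q * v (q - e μ))) (e μ)]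
      refine tsum_congr fun q => ?_
      simp only [add_sub_cancel_right]; ring
    have hC : ∑' q, (θ q / θ (q + e μ) + θ (q + e μ) / θ q) * (v q * v (q + e μ)) =
        ∑' q, θ q / θ (q + e μ) * (v q * v (q + e μ)) + ∑' q, θ (q + e μ) / θ q * (v q * v (q + e μ)) := by
      rw [← (hfwd μ).tsum_add (hbwd μ)]
      refine tsum_congr fun q => ?_
      ring
    rw [hshift, hC]
    ring
  -- the Dirichlet energy in direction `μ`
  have hexp : ∀ μ : Fin d, (fun q => (v q - v (q + e μ)) ^ 2) =
      fun q => (v q ^ 2 - 2 * (v q * v (q + e μ))) + v (q + e μ) ^ 2 := fun μ => by funext q; ring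
  have hE : ∀ μ : Fin d, ∑' q, (v q - v (q + e μ)) ^ 2 = 2 * ∑' q, v q ^ 2 - 2 * ∑' q, v q * v (q + e μ) := by
    intro μ
    rw [hexp μ, (hv2.sub ((hvv μ).mul_left 2)).tsum_add (hvv' μ), hv2.tsum_sub ((hvv μ).mul_left 2), tsum_mul_left,
      tsum_addRight (F := fun q => v q ^ 2) (e μ)]
    ring
  have hEsum : ∀ μ : Fin d, Summable fun q => (v q - v (q + e μ)) ^ 2 := fun μ => by
    rw [hexp μ]; exact (hv2.sub ((hvv μ).mul_left 2)).add (hvv' μ)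
  -- (II) the energy bounds `gap·Σ'v²` from below (intra-block bonds only, block by block)
  have hin_sum : ∀ μ : Fin d, Summable fun q => (if loc n q μ < n then (v q - v (q + e μ)) ^ 2 else 0) := fun μ =>
    Summable.of_nonneg_of_le (fun q => by split_ifs <;> positivity)
      (fun q => by split_ifs <;> nlinarith [sq_nonneg (v q - v (q + e μ))]) (hEsum μ)
  have hblock0 : ∀ y : X d, ∑ q ∈ B n y, v q = 0 := by
    intro y
    have : ∀ q ∈ B n y, v q = w y * D q := fun q hq => by simp only [hv, hθ, mem_B.1 hq]
    rw [Finset.sum_congr rfl this, ← Finset.mul_sum, hD0, mul_zero]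
  have hEnergy : gap * ∑' q, v q ^ 2 ≤ ∑ μ : Fin d, ∑' q, (v q - v (q + e μ)) ^ 2 := by
    have h1 : ∑ μ : Fin d, ∑' q, (v q - v (q + e μ)) ^ 2 ≥
        ∑ μ : Fin d, ∑' q, (if loc n q μ < n then (v q - v (q + e μ)) ^ 2 else 0) :=
      Finset.sum_le_sum fun μ _ => (hin_sum μ).tsum_le_tsum
        (fun q => by split_ifs <;> nlinarith [sq_nonneg (v q - v (q + e μ))]) (hEsum μ)
    have h2 : ∑ μ : Fin d, ∑' q, (if loc n q μ < n then (v q - v (q + e μ)) ^ 2 else 0) =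
        ∑' q, ∑ μ : Fin d, (if loc n q μ < n then (v q - v (q + e μ)) ^ 2 else 0) :=
      (Summable.tsum_finsetSum fun μ _ => hin_sum μ).symm
    have hs : Summable fun q => ∑ μ : Fin d, (if loc n q μ < n then (v q - v (q + e μ)) ^ 2 else 0) :=
      summable_sum fun μ _ => hin_sum μ
    have h3 : ∑' q, ∑ μ : Fin d, (if loc n q μ < n then (v q - v (q + e μ)) ^ 2 else 0) =
        ∑' y, ∑ q ∈ B n y, ∑ μ : Fin d, (if loc n q μ < n then (v q - v (q + e μ)) ^ 2 else 0) :=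
      (tsum_blocks n hs).symm
    have h4 : ∑' y, gap * ∑ q ∈ B n y, v q ^ 2 ≤
        ∑' y, ∑ q ∈ B n y, ∑ μ : Fin d, (if loc n q μ < n then (v q - v (q + e μ)) ^ 2 else 0) :=
      ((summable_blocks n hv2).mul_left gap).tsum_le_tsum (fun y => hgap y v (hblock0 y)) (summable_blocks n hs)
    have h5 : ∑' y, gap * ∑ q ∈ B n y, v q ^ 2 = gap * ∑' q, v q ^ 2 := by
      rw [tsum_mul_left, tsum_blocks n hv2]
    linarith [h1, h2, h3, h4, h5]
  -- (III) the perturbation is at most `d·η·Σ'v²`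
  have hind : ∀ (μ : Fin d) (c : ℤ) (F : X d → ℝ), Summable (fun q => F q ^ 2) →
      Summable fun q => (if loc n q μ = c then F q ^ 2 else 0) := fun μ c F hF =>
    Summable.of_nonneg_of_le (fun q => by split_ifs <;> positivity) (fun q => by split_ifs <;> nlinarith [sq_nonneg (F q)]) hF
  have hPert : ∀ μ : Fin d,
      ∑' q, (θ q / θ (q + e μ) + θ (q + e μ) / θ q - 2) * (v q * v (q + e μ)) ≤
        η * (∑' q, (if loc n q μ = n then v q ^ 2 else 0) + ∑' q, (if loc n q μ = 0 then v q ^ 2 else 0)) := by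
    intro μ
    have htop := hind μ n v hv2
    have hbot := hind μ 0 v hv2
    have htop' := hind μ n (fun q => v (q + e μ)) (hvv' μ)
    -- pointwise: `(ρ − 2)·v_q v_{q+e} ≤ η·1[loc = n]·(v_q² + v_{q+e}²)`
    have hpt : ∀ q, (θ q / θ (q + e μ) + θ (q + e μ) / θ q - 2) * (v q * v (q + e μ)) ≤
        η * ((if loc n q μ = n then v q ^ 2 else 0) + (if loc n q μ = n then v (q + e μ) ^ 2 else 0)) := by
      intro q
      rcases (loc_le n q μ).lt_or_eq with hlt | heq
      · rw [hratio_in q μ hlt, div_self (hθne q), if_neg hlt.ne, if_neg hlt.ne]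
        norm_num
      · rw [if_pos heq, if_pos heq]
        have hρ0 : 0 ≤ θ q / θ (q + e μ) + θ (q + e μ) / θ q - 2 := by
          have ha := hθ0 q; have hb := hθ0 (q + e μ)
          rw [div_add_div _ _ (hθne _) (hθne _), div_sub' (mul_ne_zero (hθne _) (hθne _))]
          apply div_nonneg _ (mul_pos hb ha).le
          nlinarith [sq_nonneg (θ q - θ (q + e μ))]
        have hρ1 : θ q / θ (q + e μ) + θ (q + e μ) / θ q - 2 ≤ 2 * η := by linarith [hratio q μ]
        nlinarith [sq_nonneg (v q - v (q + e μ)), sq_nonneg (v q + v (q + e μ)), abs_nonneg (v q * v (q + e μ)),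
          mul_le_mul_of_nonneg_right hρ1 (by nlinarith [sq_nonneg (v q - v (q + e μ)), sq_nonneg (v q + v (q + e μ))] :
            (0 : ℝ) ≤ (v q ^ 2 + v (q + e μ) ^ 2) / 2)]
    have hsum1 : Summable fun q => (θ q / θ (q + e μ) + θ (q + e μ) / θ q - 2) * (v q * v (q + e μ)) := by
      have : (fun q => (θ q / θ (q + e μ) + θ (q + e μ) / θ q - 2) * (v q * v (q + e μ))) =
          fun q => (θ q / θ (q + e μ) * (v q * v (q + e μ)) + θ (q + e μ) / θ q * (v q * v (q + e μ))) - 2 * (v q * v (q + e μ)) := by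
        funext q; ring
      rw [this]; exact ((hfwd μ).add (hbwd μ)).sub ((hvv μ).mul_left 2)
    have h1 := hsum1.tsum_le_tsum hpt ((htop.add htop').mul_left η)
    rw [tsum_mul_left, htop.tsum_add htop'] at h1
    -- shift the second sum: `1[loc_μ q = n]·v(q+e)² ≤ 1[loc_μ (q+e) = 0]·v(q+e)²`, then reindex
    have h2 : ∑' q, (if loc n q μ = n then v (q + e μ) ^ 2 else 0) ≤ ∑' q, (if loc n q μ = 0 then v q ^ 2 else 0) := by
      rw [← tsum_addRight (F := fun q => if loc n q μ = 0 then v q ^ 2 else 0) (e μ)]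
      refine htop'.tsum_le_tsum (fun q => ?_) ((summable_addRight_iff (F := fun q => if loc n q μ = 0 then v q ^ 2 else 0) (e μ)).2 hbot)
      by_cases hq : loc n q μ = n
      · rw [if_pos hq, if_pos (loc_add_e_of_eq hq)]
      · rw [if_neg hq]; split_ifs <;> positivity
    nlinarith [h1, h2, hη]
  have hPert_total : ∑ μ : Fin d, ∑' q, (θ q / θ (q + e μ) + θ (q + e μ) / θ q - 2) * (v q * v (q + e μ)) ≤
      d * η * ∑' q, v q ^ 2 := by
    have hface : ∀ μ : Fin d, ∑' q, (if loc n q μ = n then v q ^ 2 else 0) + ∑' q, (if loc n q μ = 0 then v q ^ 2 else 0) ≤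
        ∑' q, v q ^ 2 := by
      intro μ
      have htop := hind μ n v hv2
      have hbot := hind μ 0 v hv2
      rw [← htop.tsum_add hbot]
      refine (htop.add hbot).tsum_le_tsum (fun q => ?_) hv2
      have hn0 : (n : ℤ) ≠ 0 := by exact_mod_cast (Nat.one_le_iff_ne_zero.1 hn)
      by_cases h1 : loc n q μ = n
      · rw [if_pos h1, if_neg (by rw [h1]; exact hn0), add_zero]
      · rw [if_neg h1, zero_add]; split_ifs <;> nlinarith [sq_nonneg (v q)]
    calc ∑ μ : Fin d, ∑' q, (θ q / θ (q + e μ) + θ (q + e μ) / θ q - 2) * (v q * v (q + e μ))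
        ≤ ∑ μ : Fin d, η * ∑' q, v q ^ 2 := Finset.sum_le_sum fun μ _ => (hPert μ).trans
            (mul_le_mul_of_nonneg_left (hface μ) hη)
      _ = d * η * ∑' q, v q ^ 2 := by rw [Finset.sum_const, Finset.card_univ, Fintype.card_fin, nsmul_eq_mul]; ring
  -- (IV) assemble: `(gap − dη)·Σ'v² ≤ J ≤ √(Σ'v²)·√(Σ_T (θR)²)`
  have hJ_lower : (gap - d * η) * ∑' q, v q ^ 2 ≤ ∑' q, (θ q * v q) * lapRow D q := by
    rw [hJ2]
    have hrewrite : ∀ μ : Fin d, 2 * ∑' q, v q ^ 2 - ∑' q, (θ q / θ (q + e μ) + θ (q + e μ) / θ q) * (v q * v (q + e μ)) =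
        ∑' q, (v q - v (q + e μ)) ^ 2 - ∑' q, (θ q / θ (q + e μ) + θ (q + e μ) / θ q - 2) * (v q * v (q + e μ)) := by
      intro μ
      rw [hE μ]
      have hs : (fun q => (θ q / θ (q + e μ) + θ (q + e μ) / θ q - 2) * (v q * v (q + e μ))) =
          fun q => (θ q / θ (q + e μ) + θ (q + e μ) / θ q) * (v q * v (q + e μ)) - 2 * (v q * v (q + e μ)) := by
        funext q; ring
      have hsum2 : Summable fun q => (θ q / θ (q + e μ) + θ (q + e μ) / θ q) * (v q * v (q + e μ)) := by
        have : (fun q => (θ q / θ (q + e μ) + θ (q + e μ) / θ q) * (v q * v (q + e μ))) =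
            fun q => θ q / θ (q + e μ) * (v q * v (q + e μ)) + θ (q + e μ) / θ q * (v q * v (q + e μ)) := by
          funext q; ring
        rw [this]; exact (hfwd μ).add (hbwd μ)
      rw [hs, hsum2.tsum_sub ((hvv μ).mul_left 2), tsum_mul_left]
      ring
    rw [Finset.sum_congr rfl fun μ _ => hrewrite μ, Finset.sum_sub_distrib]
    linarith [hEnergy, hPert_total]
  have hCS : -∑ q ∈ T, v q * (θ q * R q) ≤ Real.sqrt (∑' q, v q ^ 2) * Real.sqrt (∑ q ∈ T, (θ q * R q) ^ 2) := by
    have h1 : (∑ q ∈ T, v q * (θ q * R q)) ^ 2 ≤ (∑ q ∈ T, v q ^ 2) * ∑ q ∈ T, (θ q * R q) ^ 2 :=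
      Finset.sum_mul_sq_le_sq_mul_sq T v fun q => θ q * R q
    have h2 : ∑ q ∈ T, v q ^ 2 ≤ ∑' q, v q ^ 2 := hv2.sum_le_tsum T fun q _ => sq_nonneg _
    have h3 : |∑ q ∈ T, v q * (θ q * R q)| ≤ Real.sqrt (∑' q, v q ^ 2) * Real.sqrt (∑ q ∈ T, (θ q * R q) ^ 2) := by
      rw [← Real.sqrt_mul (tsum_nonneg fun q => sq_nonneg _), ← Real.sqrt_sq_eq_abs]
      exact Real.sqrt_le_sqrt (h1.trans (mul_le_mul_of_nonneg_right h2 (Finset.sum_nonneg fun q _ => sq_nonneg _)))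
    linarith [neg_abs_le (∑ q ∈ T, v q * (θ q * R q))]
  -- conclude
  have hS0 : 0 ≤ ∑' q, v q ^ 2 := tsum_nonneg fun q => sq_nonneg _
  set A := Real.sqrt (∑' q, v q ^ 2) with hA
  have hAA : A * A = ∑' q, v q ^ 2 := Real.mul_self_sqrt hS0
  have hmain : (gap - d * η) * (A * A) ≤ A * Real.sqrt (∑ q ∈ T, (θ q * R q) ^ 2) := by
    rw [hAA]; linarith [hJ_lower, hJ1, hCS]
  have hgoal : (gap - d * η) * A ≤ Real.sqrt (∑ q ∈ T, (θ q * R q) ^ 2) := by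
    rcases (Real.sqrt_nonneg (∑' q, v q ^ 2)).lt_or_eq with hpos | hzero
    · exact le_of_mul_le_mul_right (by nlinarith [hmain]) hpos
    · rw [← hA] at hzero; rw [← hzero, mul_zero]; exact Real.sqrt_nonneg _
  simpa only [hv, hθ] using hgoal

end

end Summit.QuantumFields.BalabanUV.T4Continuum.NE7b.BlockSectionAgmonEngine
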